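import Summits.QuantumFields.YangMills.Theorems.BalabanUVNodesN07ChartTopBoxDataSmall
import HarnessLib

/-!
# N07 [B11] (= [15] = [Balaban1985Variational]) Sect. F — THE TWO-BLOCK LETTER `a` OF THE DENT ROWS SUPPLIED BY THE DATA (print p. 303 «|V₁(∂p) − 1| < 2L²ε₁ for p ⊂ □̃′^{(k−1)}», here at
# the (k−1)-data itself: every level-`m` plaquette of `M^m U` based in the blocks of a DENT PAIR is a PRINTED (7) plaquette of level `m`, hence `< δ_m`) — the displayed `hA` of MODULE 71

Cell `pub-ymgap`, seat `pub-ymgap-dag-n07-e` g24 (FAN-OUT §N07 row s3; LANE OWNER of the K0 road), MODULE 72 (OUTWARD-MEET-EDITION-SPEC §10 (C1b)).  `--kind proof --supports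
stmt-QuantumFields-20541 --as helper` (K0⁷); count-neutral; def-free.  [15] = [Balaban1985Variational]; [III] = [Balaban1988Convergent]; [6] = [Balaban1985RegularSpaces].

WHAT.  MODULE 71 (`…N07DentRowsTwoBlocks`) bounds the dent rows of the chart's datum modulo ONE displayed letter
`hA : PlaqSmallOn (boxPlaqs (L·t) (L·(t + e_μ) + (L−1))) a (Averaging.iter (avOfRecord F N K) m U)` — the level-`m` plaquettes of `M^m U` based in the two blocks of the pair.  For a DENT
PAIR (both labels `t`, `t + e_μ` of the chart's top box OFF `Γ_{m+1}`: outside `Ω_{m+1}`, inside `Ω_m`) these plaquettes have all four vertices in `Γ_m^{(m)}`, so they are PRINTED (7)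
plaquettes of level `m` on which the (7) field is `W_m = M^m U` (the fibre) — MODULE 69a's non-touching analysis one level down, on a general box of labels.  §1 is generic (any box of labels
all of whose vertices take the dichotomy's SECOND branch); §2 reads it at the record at a dent pair of a meeting, print-margin-clean datum, discharging margin ∕ collar ∕ support ∕
saturation exactly as MODULE 69b, with `a = δ_m`.

WHAT IS PROVED (sorry-free; no definition; axioms standard; by-name composition — NOTHING of [15]∕[6] analysis).
§1 ★★ `plaqSmallOn_blowDown_iter_of_below` (generic `Ω`, `W`, `U`; `m + 1 ≤ k`): for an integer box `[tlo, thi]` of level-`(m+1)` labels such that every level-`m` site under each label lies in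
`Γ_m^{(m)}`, the fibre at level `m`, the data's level-`m` clause (`m ≥ 1`) ∕ top-domain clause (`m = 0`, unit boxes inside `Ω₀`): `PlaqSmallOn (boxPlaqs (L·tlo) (L·thi + (L−1))) a (M^m U)`.
§2 ★★★ `plaqSmallOn_dentPair_iter_of_data F N` (at the record, the knit's binders as MODULE 69b + the pair's labels in the chart box and OFF `Γ_{m+1}`):
`PlaqSmallOn (boxPlaqs (L·t) (L·(t + e_μ) + (L−1))) (δ_m) (Averaging.iter (avOfRecord F N K) m U)` — MODULE 71's `hA` with `a := δ_m` (δ-type).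

HONEST SCOPE.  Count-neutral; the fibre, the data's (7), the run's letters and the dent-pair premise (`castSite t, castSite (t+e_μ) ∉ Γ_{m+1}`) are HYPOTHESES; which `D″`-LamBonds form dent
pairs and ⚑ LOCATED-DENT-BOUNDARY's bonds are NOT here; nothing of Bałaban asserted; K0⁷ ∕ K1⁹ NOT closed; N07 NOT discharged; counts unmoved (typed 28∕28 · discharged 5∕27); one finite 𝕋⁴
programme at fixed ε — the route closes the conditional finite-𝕋⁴ rung `BalabanLadder.UV` ONLY; the YM mass gap (Clay) is NOT proved by any of this; nothing continuum ∕ ℝ⁴ ∕ OS.  No `sorry`,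
no `def`, no `instance`, no `notation`.

References: [15] (7) p. 278 L20–33, (13) p. 280, (144) p. 300, (160) p. 303; [III] p. 255, (2.2) p. 255, (2.10)–(2.11) p. 256; [6] p. 98, (1.3)–(1.6) p. 77.
-/

set_option autoImplicit false

noncomputable section
open scoped BigOperators Matrix.Norms.L2Operator

namespace Summit.QuantumFields.YangMills.BalabanUVNodes.N07DentPairDataSmall

open Literature.MathematicalPhysics.QuantumFieldTheory.Balaban1983to89
open Literature.MathematicalPhysics.QuantumFieldTheory.Balaban1983to89.Node00
open Literature.MathematicalPhysics.QuantumFieldTheory.Balaban1983to89.B15DeterminingSets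
open T4Continuum (T4Family)
open T4AxialGaugeSmallField (castSite castSite_apply castSite_add_e boxPlaqs)
open B15Eq112TorusCover (cover)
open B14DomainGeom (Pt Within)
open B7Prop1Explicit (e e_apply)
open B8Eq131Cubes (box bLo bHi sqLo sqHi)
open B5Eq118OneStroke (iterBlockOf)
open GaugeField (plaqHol)
open B8Eq17ClassAkV1 (plaqsOf mem_plaqsOf)
open Summit.QuantumFields.YangMills.BalabanUVNodes.N07DataDownTheTowerBlowDown (blockOf_mem_box_of_mem_blowDown ediv_mem_Icc_of_mem_blowDown)
open Summit.QuantumFields.YangMills.BalabanUVNodes.N07ChartTopBoxPlaquetteValues (corner_dichotomy)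
open Summit.QuantumFields.YangMills.BalabanUVNodes.N07ChartTopBoxDataSmall (unitBox_subset_chartBox exists_mem_box_within_of_mem_chartBox)
open Summit.QuantumFields.YangMills.BalabanUVNodes.N07SplitClauseLevelRaisingMarginWide (chartTopBox_subset_wboxPrint)
open Summit.QuantumFields.YangMills.BalabanUVNodes.N07RecordDomainsAdm22 (blockSat_seqOfRecord)

/-! ## §1  Generic: a box of labels all below `Γ_m` -/

section Generic

variable (F : T4Family) (N : ℕ) [NeZero N] (K : ℕ) {m k : ℕ} (Ω : ℕ → Set (Site (F.P K) 0)) (W : MSField (F.P K) (SU N)) (U : GaugeField (F.P K) 0 (SU N))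

/-- ★★ **THE PLAQUETTES UNDER A BOX OF LABELS BELOW `Γ_m` ARE PRINTED (7) PLAQUETTES, HENCE SMALL**: if every level-`m` site under each label of `[tlo, thi]` lies in `Γ_m^{(m)}` (the dichotomy's
second branch), then every level-`m` plaquette based in the blow-down box `[L·tlo, L·thi + (L−1)]` has its four vertices in `Γ_m` — all its bonds meet `Γ_m` (fibre: `M^m U = W_m` on them), none
lies inside `Ω_{m+1}` — so the data's level-`m` clause (`m ≥ 1`; for `m = 0` the top-domain clause, the plaquette meeting `Ω₀`) makes it `< a`.
[cite: Balaban1985Variational, (7) p.278 L20–33, (160) p.303; Balaban1988Convergent, (2.2), (2.10) pp.255–256] -/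
theorem plaqSmallOn_blowDown_iter_of_below (hmk : m + 1 ≤ k) (hm : m + 1 ≤ (F.P K).m + (F.P K).K)
    (hfib : AgreeOn (genSet Ω k) (avgFamily (avOfRecord F N K) U) W) {a : ℝ}
    (h7m : 1 ≤ m → ∀ q : Plaq (F.P K) m, q ∈ Sect2.printedPlaqs Ω k m → (∀ c : PBond (F.P K) m,
        (c = ⟨q.src, q.μ⟩ ∨ c = ⟨q.src.shift q.μ, q.ν⟩ ∨ c = ⟨q.src.shift q.ν, q.μ⟩ ∨ c = ⟨q.src, q.ν⟩) → c ∈ bondsOf (genSet Ω k m)) → dist1 (plaqHol (W m) q) < a)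
    {Ω₀ : Set (Site (F.P K) 0)} (h70 : m = 0 → PlaqSmallOn (Sect2.printedPlaqsTop Ω Ω₀ k) a (W 0))
    {tlo thi : Pt (F.P K).d}
    (hgood2 : ∀ t ∈ Set.Icc tlo thi, ∀ y' : Site (F.P K) m, blockOf y' = (castSite t : Site (F.P K) (m + 1)) → y' ∈ genSet Ω k m)
    (hsupp : m = 0 → ∀ t ∈ Set.Icc tlo thi, ∀ z ∈ box (F.P K).L t 1 (m + 1), cover (F.P K) z ∈ Ω₀) :
    PlaqSmallOn (boxPlaqs (fun i => ((F.P K).L : ℤ) * tlo i) (fun i => ((F.P K).L : ℤ) * thi i + (((F.P K).L : ℤ) - 1))) a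
      (Averaging.iter (avOfRecord F N K) m U) := by
  intro q hq
  obtain ⟨w, hwlo, hwhi, hwsrc⟩ := hq
  have heμ : ∀ κ i : Fin (F.P K).d, (0 : ℤ) ≤ e κ i ∧ e κ i ≤ 1 := fun κ i => by rw [e_apply]; split_ifs <;> norm_num
  -- the four vertices of `q` as labels in the blow-down box: each lies below a label of `[tlo, thi]`, hence in `Γ_m`
  have hvert : ∀ w' : Pt (F.P K).d, (w' = w ∨ w' = w + e q.μ ∨ w' = w + e q.ν ∨ w' = w + e q.μ + e q.ν) →
      (castSite w' : Site (F.P K) m) ∈ genSet Ω k m := by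
    intro w' hw'
    have hw'box : w' ∈ Set.Icc (fun i => ((F.P K).L : ℤ) * tlo i) (fun i => ((F.P K).L : ℤ) * thi i + (((F.P K).L : ℤ) - 1)) := by
      constructor <;> intro i
      · have := hwlo i
        rcases hw' with rfl | rfl | rfl | rfl <;> simp only [Pi.add_apply] <;> linarith [(heμ q.μ i).1, (heμ q.ν i).1]
      · have := hwhi i
        simp only [Pi.add_apply] at this
        rcases hw' with rfl | rfl | rfl | rfl <;> simp only [Pi.add_apply] <;> linarith [(heμ q.μ i).1, (heμ q.ν i).1]
    obtain ⟨t, htI, htb⟩ := blockOf_mem_box_of_mem_blowDown hm (⟨w', hw'box, rfl⟩ :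
      (castSite w' : Site (F.P K) m) ∈ (castSite '' Set.Icc (fun i => ((F.P K).L : ℤ) * tlo i) (fun i => ((F.P K).L : ℤ) * thi i + (((F.P K).L : ℤ) - 1)) : Set (Site (F.P K) m)))
    exact hgood2 t htI (castSite w') htb.symm
  have h1 := hvert w (Or.inl rfl)
  have h2 : (castSite w : Site (F.P K) m).shift q.μ ∈ genSet Ω k m := by rw [← castSite_add_e]; exact hvert _ (Or.inr (Or.inl rfl))
  have h3 : (castSite w : Site (F.P K) m).shift q.ν ∈ genSet Ω k m := by rw [← castSite_add_e]; exact hvert _ (Or.inr (Or.inr (Or.inl rfl)))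
  -- all four bonds of `q` meet `Γ_m`: the fibre gives `M^m U = W_m` on them
  have hbonds : ∀ c : PBond (F.P K) m, (c = ⟨q.src, q.μ⟩ ∨ c = ⟨q.src.shift q.μ, q.ν⟩ ∨ c = ⟨q.src.shift q.ν, q.μ⟩ ∨ c = ⟨q.src, q.ν⟩) →
      c ∈ bondsOf (genSet Ω k m) := by
    intro c hc
    rw [hwsrc] at hc
    rcases hc with rfl | rfl | rfl | rfl
    · exact Or.inl h1
    · exact Or.inl h2
    · exact Or.inl h3
    · exact Or.inl h1
  have hf : ∀ c : PBond (F.P K) m, c ∈ bondsOf (genSet Ω k m) → Averaging.iter (avOfRecord F N K) m U c = W m c := fun c hc => hfib m c hc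
  have hplaq : plaqHol (Averaging.iter (avOfRecord F N K) m U) q = plaqHol (W m) q := by
    unfold GaugeField.plaqHol
    rw [hf _ (hbonds _ (Or.inl rfl)), hf _ (hbonds _ (Or.inr (Or.inl rfl))), hf _ (hbonds _ (Or.inr (Or.inr (Or.inl rfl)))),
      hf _ (hbonds _ (Or.inr (Or.inr (Or.inr rfl))))]
  rw [hplaq]
  -- `Γ_m` misses `Ω_{m+1}`: `q` has no bond inside `Ω_{m+1}`
  have hΓ : ∀ y : Site (F.P K) m, y ∈ genSet Ω k m → y ∉ pts m (Ω (m + 1)) := by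
    intro y hy habs
    have hy' : embIter m y ∈ gammaRegion Ω k m := (mem_pts.1 hy)
    rw [mem_pts] at habs
    rcases Nat.eq_zero_or_pos m with h0 | h0
    · subst h0; rw [gammaRegion_zero Ω (by omega)] at hy'; exact hy' habs
    · rw [gammaRegion_mid Ω h0 (by omega)] at hy'; exact hy'.2 habs
  have hprinted : q ∈ Sect2.printedPlaqs Ω k m := by
    refine ⟨?_, fun h => hΓ _ h1 (hwsrc ▸ h.1), fun h => hΓ _ h2 (hwsrc ▸ h.1), fun h => hΓ _ h3 (hwsrc ▸ h.1), fun h => hΓ _ h1 (hwsrc ▸ h.1)⟩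
    rw [mem_plaqsOf, hwsrc]; exact Or.inl h1
  rcases Nat.eq_zero_or_pos m with h0 | h0
  · -- level `0`: the top-domain clause; the plaquette meets `Ω₀` at its lower corner
    subst h0
    refine h70 rfl q ⟨hprinted, ?_⟩
    rw [mem_plaqsOf, hwsrc]
    left
    have hwbox : w ∈ Set.Icc (fun i => ((F.P K).L : ℤ) * tlo i) (fun i => ((F.P K).L : ℤ) * thi i + (((F.P K).L : ℤ) - 1)) :=
      ⟨hwlo, fun i => by have := hwhi i; simp only [Pi.add_apply] at this ⊢; linarith [(heμ q.μ i).1, (heμ q.ν i).1]⟩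
    have htI := ediv_mem_Icc_of_mem_blowDown (F.P K).L_pos hwbox
    have hunit : w ∈ box (F.P K).L (fun i => w i / ((F.P K).L : ℤ)) 1 (0 + 1) := by
      intro i
      simp only [bLo, bHi, Nat.cast_zero, sub_zero, add_zero, Nat.cast_one, zero_add, pow_one]
      have hL0 : (0 : ℤ) < (F.P K).L := by exact_mod_cast (F.P K).L_pos
      constructor
      · have := Int.ediv_mul_le (w i) hL0.ne'; linarith
      · have := Int.lt_ediv_add_one_mul_self (w i) hL0; linarith
    exact hsupp rfl _ htI w hunit
  · exact h7m h0 q hprinted hbonds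

end Generic

/-! ## §2  At the record: the two blocks of a dent pair of the chart's top box -/

section Record

variable (F : T4Family) (N : ℕ) [NeZero N]

/-- ★★★ **THE TWO-BLOCK LETTER OF A DENT PAIR IS THE (j−1)-DATA's `δ_{j−1}`** (print p. 303 «|V₁(∂p) − 1| < 2L²ε₁ for p ⊂ □̃′^{(k−1)}», at the data itself): at a meeting, print-margin-clean
datum `(j, idx)`, `j = m + 1`, of a separated run (the binders of MODULE 69b), for two labels `t`, `t + e_μ` of the chart's top box `[sqLo_j − 1, sqHi_j + 1]` that are OFF `Γ_j` (the DENT ∕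
collar side: `castSite t, castSite (t + e_μ) ∉ genSet s.Ω k j`), the level-`m` plaquettes of `M^m U` based in the two blocks are `< δ_m` — MODULE 71's `hA` with `a := δ_m`.  Margin ∕ collar
∕ support ∕ saturation discharged as in MODULE 69b; the dichotomy's second branch by MODULE 69a₁ `corner_dichotomy`.
[cite: Balaban1985Variational, (7) p.278, (144) p.300, (160) p.303; Balaban1988Convergent, p.255, (2.2), (2.10)–(2.13) pp.255–257; Balaban1985RegularSpaces, p.98] -/
theorem plaqSmallOn_dentPair_iter_of_data {ν : Stage7Numerics} {M : ℕ} {g : ℕ → ℝ} {K k : ℕ} (s : SeqOfRecord F ν M g K k)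
    (hsep : Sect2.SeqSeparated ν.M₁ s) (hkK : k ≤ (F.P K).m + (F.P K).K)
    (hgrid : ∀ j : ℕ, 1 ≤ j → j ≤ k → dCubeSide (F.P K).L M (RkOfRecord (F.P K).L ν.r (g j)) j ∣ (F.P K).sitesPerDir 0)
    {Mc ρ : ℕ} (hMc : 1 ≤ Mc) (hρ : 1 ≤ ρ) (hfloor : (11 * (F.P K).d + 4 * ρ + Mc) * (F.P K).L + 3 ≤ ν.M₁)
    {δ : ℕ → ℝ} (W : MSField (F.P K) (SU N)) (h7 : Sect2.DataSmall7PTop (avOfRecord F N K) s.Ω (suppDomOfRecord F ν K s.Ω) k δ W)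
    (U : GaugeField (F.P K) 0 (SU N)) (hfib : AgreeOn (genSet s.Ω k) (avgFamily (avOfRecord F N K) U) W)
    {m : ℕ} (hjk : m + 1 ≤ k) (hjK : m + 1 ≤ (F.P K).m + (F.P K).K) (idx : Pt (F.P K).d)
    (hmeet : ∃ x ∈ box (F.P K).L (cornerP (F.P K) Mc ρ idx) (sideP (F.P K) Mc ρ) (m + 1), ∃ y : Pt (F.P K).d, cover (F.P K) y ∈ s.Ω (m + 1) ∧ Within ((3 : ℕ) : ℤ) x y)
    (hclean : m + 1 = k ∨ ∀ z ∈ box (F.P K).L (cornerP (F.P K) Mc ρ idx - ((2 * ρ : ℕ) : Pt (F.P K).d)) (sideP (F.P K) Mc ρ + 2 * (2 * ρ)) (m + 1),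
      cover (F.P K) z ∉ s.Ω (m + 1 + 1))
    (t : Pt (F.P K).d) (μ : Fin (F.P K).d)
    (ht : t ∈ Set.Icc (sqLo (F.P K).L (cornerP (F.P K) Mc ρ idx) ρ (m + 1) (m + 1) - 1) (sqHi (F.P K).L (cornerP (F.P K) Mc ρ idx) (sideP (F.P K) Mc ρ) ρ (m + 1) (m + 1) + 1))
    (htμ : t + e μ ∈ Set.Icc (sqLo (F.P K).L (cornerP (F.P K) Mc ρ idx) ρ (m + 1) (m + 1) - 1) (sqHi (F.P K).L (cornerP (F.P K) Mc ρ idx) (sideP (F.P K) Mc ρ) ρ (m + 1) (m + 1) + 1))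
    (hdent : (castSite t : Site (F.P K) (m + 1)) ∉ genSet s.Ω k (m + 1)) (hdentμ : (castSite (t + e μ) : Site (F.P K) (m + 1)) ∉ genSet s.Ω k (m + 1)) :
    PlaqSmallOn (boxPlaqs (fun i => ((F.P K).L : ℤ) * t i) (fun i => ((F.P K).L : ℤ) * (t + e μ) i + (((F.P K).L : ℤ) - 1))) (δ m)
      (Averaging.iter (avOfRecord F N K) m U) := by
  set c : Pt (F.P K).d := cornerP (F.P K) Mc ρ idx with hc
  set S : ℕ := sideP (F.P K) Mc ρ with hS
  have hν0 : 0 < ν.M₁ := by omega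
  have hν1 : 1 ≤ ν.M₁ := hν0
  have hρ0 : 0 < ρ := hρ
  have hS1 : 1 ≤ S := by have := le_sideP (P := F.P K) Mc hρ0; omega
  -- block saturation of `Ω_{m+1}`
  have hsat : ∀ x x' : Site (F.P K) 0, iterBlockOf (m + 1) x = iterBlockOf (m + 1) x' → x ∈ s.Ω (m + 1) → x' ∈ s.Ω (m + 1) :=
    fun x x' => blockSat_seqOfRecord F ν M g K k hkK s hgrid (m + 1) x x' (by omega) hjk
  -- the data's clauses at level `m`
  have h7m : 1 ≤ m → ∀ q : Plaq (F.P K) m, q ∈ Sect2.printedPlaqs s.Ω k m → (∀ c' : PBond (F.P K) m,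
      (c' = ⟨q.src, q.μ⟩ ∨ c' = ⟨q.src.shift q.μ, q.ν⟩ ∨ c' = ⟨q.src.shift q.ν, q.μ⟩ ∨ c' = ⟨q.src, q.ν⟩) → c' ∈ bondsOf (genSet s.Ω k m)) → dist1 (plaqHol (W m) q) < δ m := by
    intro h1 q hq hb
    obtain ⟨m', rfl⟩ : ∃ m', m = m' + 1 := ⟨m - 1, by omega⟩
    have h7' := h7.2 m' (by omega) q hq
    have heq : plaqHol (Sect2.mixedField (avOfRecord F N K) (genSet s.Ω k (m' + 1)) (W (m' + 1)) (W m')) q = plaqHol (W (m' + 1)) q := by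
      unfold GaugeField.plaqHol
      rw [Sect2.mixedField_of_mem _ _ _ (hb _ (Or.inl rfl)), Sect2.mixedField_of_mem _ _ _ (hb _ (Or.inr (Or.inl rfl))),
        Sect2.mixedField_of_mem _ _ _ (hb _ (Or.inr (Or.inr (Or.inl rfl)))), Sect2.mixedField_of_mem _ _ _ (hb _ (Or.inr (Or.inr (Or.inr rfl))))]
    rwa [heq] at h7'
  have h70 : m = 0 → PlaqSmallOn (Sect2.printedPlaqsTop s.Ω (suppDomOfRecord F ν K s.Ω) k) (δ m) (W 0) := by
    intro h0; subst h0; exact h7.1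
  -- (i) margin, (ii) collar, (iii) support — for every label of the chart box (as MODULE 69b)
  have hfar : ∀ t' ∈ Set.Icc (sqLo (F.P K).L c ρ (m + 1) (m + 1) - 1) (sqHi (F.P K).L c S ρ (m + 1) (m + 1) + 1),
      ∀ z ∈ box (F.P K).L t' 1 (m + 1), cover (F.P K) z ∉ s.Ω (m + 2) := by
    intro t' ht' z hz
    rcases hclean with htop | hcl
    · rw [s.Ω_off (m + 2) (by omega)]; exact Set.notMem_empty _
    · exact hcl z (chartTopBox_subset_wboxPrint (F.P K).L c S (m + 1) hρ (unitBox_subset_chartBox c S ρ (m + 1) ht' hz))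
  obtain ⟨x₀, hx₀, y₀, hy₀, hxy₀⟩ := hmeet
  have hcol : 1 ≤ m → ∀ t' ∈ Set.Icc (sqLo (F.P K).L c ρ (m + 1) (m + 1) - 1) (sqHi (F.P K).L c S ρ (m + 1) (m + 1) + 1),
      ∀ z ∈ box (F.P K).L t' 1 (m + 1), cover (F.P K) z ∈ s.Ω m := by
    intro h1 t' ht' z hz
    obtain ⟨y', hy', hzy'⟩ := exists_mem_box_within_of_mem_chartBox c hS1 hρ (m + 1) ht' hz
    have hfl : 11 * (F.P K).d + 2 * ρ + Mc + 3 + 2 * ρ ≤ ν.M₁ := by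
      have hL1 : 1 ≤ (F.P K).L := (F.P K).L_pos
      have : 11 * (F.P K).d + 4 * ρ + Mc ≤ (11 * (F.P K).d + 4 * ρ + Mc) * (F.P K).L := Nat.le_mul_of_pos_right _ hL1
      omega
    have h := Sect2.cover_mem_Ω_pred_of_near_box_propCubeP_box (P := F.P K) hν1 s hsep (Dw := 3) (E := 2 * ρ) hfl (n := m + 1) (by omega) hjk hx₀ hy₀ hxy₀
      (z := z) (y' := y') hy' (by simpa [mul_comm, mul_assoc] using hzy')
    simpa using h
  have hsupp : m = 0 → ∀ t' ∈ Set.Icc t (t + e μ), ∀ z ∈ box (F.P K).L t' 1 (m + 1), cover (F.P K) z ∈ suppDomOfRecord F ν K s.Ω := by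
    intro h0 t' ht' z hz
    subst h0
    -- every label of `[t, t + e_μ]` is a chart-box label
    have ht'box : t' ∈ Set.Icc (sqLo (F.P K).L c ρ (0 + 1) (0 + 1) - 1) (sqHi (F.P K).L c S ρ (0 + 1) (0 + 1) + 1) :=
      ⟨fun i => le_trans (ht.1 i) (ht'.1 i), fun i => le_trans (ht'.2 i) (htμ.2 i)⟩
    obtain ⟨y', hy', hzy'⟩ := exists_mem_box_within_of_mem_chartBox c hS1 hρ (0 + 1) ht'box hz
    have hbox := within_of_mem_box_of_mem_box (F.P K).L hy' hx₀
    have hw := (hzy'.triangle hbox).triangle hxy₀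
    rw [suppDomOfRecord_eq]
    refine cover_mem_hullD_one_of_within hν0 hy₀ (hw.mono ?_)
    have hSle : (S : ℤ) ≤ Mc + 11 * (F.P K).d + 2 * ρ := by exact_mod_cast sideP_le (P := F.P K) Mc ρ
    have hf : (((11 * (F.P K).d + 4 * ρ + Mc) * (F.P K).L + 3 : ℕ) : ℤ) ≤ ν.M₁ := by exact_mod_cast hfloor
    push_cast at hf ⊢
    have hL0 : (0 : ℤ) ≤ (F.P K).L := by positivity
    nlinarith
  -- the dichotomy's SECOND branch at both labels (they are OFF `Γ_{m+1}`), hence at every label of `[t, t + e_μ]`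
  have hlab : ∀ t' ∈ Set.Icc t (t + e μ), t' ∈ Set.Icc (sqLo (F.P K).L c ρ (m + 1) (m + 1) - 1) (sqHi (F.P K).L c S ρ (m + 1) (m + 1) + 1) :=
    fun t' ht' => ⟨fun i => le_trans (ht.1 i) (ht'.1 i), fun i => le_trans (ht'.2 i) (htμ.2 i)⟩
  have heμ : ∀ κ : Fin (F.P K).d, (0 : ℤ) ≤ e μ κ ∧ e μ κ ≤ 1 := fun κ => by rw [e_apply]; split_ifs <;> norm_num
  have htwo : ∀ t' ∈ Set.Icc t (t + e μ), t' = t ∨ t' = t + e μ := by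
    intro t' ht'
    by_cases hμ' : t' μ = t μ
    · left
      funext i
      have a1 : t i ≤ t' i := ht'.1 i
      have a2 : t' i ≤ (t + e μ) i := ht'.2 i
      simp only [Pi.add_apply, e_apply] at a2
      by_cases hi : i = μ
      · subst hi; exact hμ'
      · rw [if_neg hi] at a2; linarith
    · right
      funext i
      have a1 : t i ≤ t' i := ht'.1 i
      have a2 : t' i ≤ (t + e μ) i := ht'.2 i
      simp only [Pi.add_apply, e_apply] at a2 ⊢
      by_cases hi : i = μ
      · subst hi
        rw [if_pos rfl] at a2 ⊢
        have : t' i ≠ t i := hμ'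
        omega
      · rw [if_neg hi] at a2 ⊢; linarith
  have hgood2 : ∀ t' ∈ Set.Icc t (t + e μ), ∀ y' : Site (F.P K) m, blockOf y' = (castSite t' : Site (F.P K) (m + 1)) → y' ∈ genSet s.Ω k m := by
    intro t' ht' y' hy'
    have hd := corner_dichotomy s.Ω hjk hjK hsat (hfar t' (hlab t' ht')) (fun h1 => hcol h1 t' (hlab t' ht'))
    rcases hd with h | h
    · exfalso
      rcases htwo t' ht' with rfl | rfl
      · exact hdent h
      · exact hdentμ h
    · exact h y' hy'
  exact plaqSmallOn_blowDown_iter_of_below F N K s.Ω W U hjk hjK hfib h7m h70 hgood2 hsupp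

end Record

end Summit.QuantumFields.YangMills.BalabanUVNodes.N07DentPairDataSmall

end
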